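import Summits.Schanuel.Schanuel.Theorems.RootDecomp1KArcCell10

/-!
# RootDecomp1KArcCell — lens 1, generation 50, node 9 «THE ARC ENGINE: separation by positive-dimensional containment; members ρ° = Π(1+4^(−k!)) and the twin σ° = Π(1+2·4^(−k!)); item 33364 decided hyp-free at zA = (1, ℓ₂, ρ°), zD = (1, ρ°, σ°) and π-twins» — continuation (RootDecomp1KArcCell11): §11 the twin cell, its walls + §12 head the twin members zD / zDpi

(lens-1 g50 HOME kernel K = HOME/decomp-schanuel-lens-1/g50/ArcCell.lean 10f1e0d5…, 3410 l · 258 decl lines, imports …RootDecomp1KCollarWall05 + …RootDecomp1KCommonRadixCell04 + …RootDecomp1KNWMeasureHolds BY NAME; P ArcCellProbe.lean af7624ff… rc 0 / C₀ ArcCellCtrl0.lean d71f613e… rc 0 / C ArcCellCtrl.lean 242a3b02… rc 1 = 42 planted; memo NODE-g50.md; CLAIM L2466, EX-ANTE PRICE + CHECKLIST K-g50 L2467, NODE L2469 / REQUEST L2470 (with the lens's ex-post self-correction: both members fall to printed dominance in substance — zA directly by Bundschuh LNM 1415 p.78 / Zhu 推论 1.3.3, zD after τ = σ°/ρ°²);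 critic VERDICT L2473: CLEARED AS PRICED EX ANTE — ONE CELL ×1 «ARC CELL (TYPED-LEVEL)» with the SUBSTANCE CAVEAT OF RECORD (both members inside the archimedean dominance class in substance; E2 convenient, not necessary), RULE K-R39 FIXED, PORT GO. Port by census-1 gen 21 as `RootDecomp1KArcCell01–13` along K's §1–§12 with §4, §7 and §12 cut at decl boundaries by the 400-line file cap: 01 = §1 (E1) `aeval_one_div_two_pow_ne_zero` (dyadic root lemma) + §2 (E2) `toPolyPoly`, `arc_count` (a relation contains ≤ deg q of an injective family of rational arcs — roots over the domain ℚ[X]); 02 = §3 (A) the member: `dfac`, `arcNum`, `arcProdQ` (ρ°_N), `sQ`, `rhoArc` (ρ° = Π(1 + 4^(−k!))) and its tails; 03 = §4a (E3) `TruncGenericSeq` («[class] definition» tag) + **`algebraicIndependent_of_truncGenericSeq`** (the g36/g37 extraction re-plumbed to arbitrary dyadic-type schedules); 04 = §4b `psQ`, the link `truncGeneric_iff_truncGenericSeq` and the tree (X′) re-derived — K's `theorem algebraicIndependent_liouville_of_truncGeneric'` DEMOTED to a documented `example` (its statement is byte-identical to the tree's `RootDecomp1KCommonRadixCell.algebraicIndependent_liouville_of_truncGeneric`,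 CommonRadixCell03 l.98 — dedup twin flagged by the writer L2472 (α), demotion pre-sanctioned by the critic L2473; nothing in K uses the primed name); 05 = §5 the arcs of ρ°: `arcPoly`, `arcF`, `arcBasis`, `arcScal`, `clearArc`, `truncGenericSeq_arc`, tightness `qArc` / `qArc_tight`; 06 = §6 the arc cell `algebraicIndependent_arc_of_mvPolyMeasure`, `algebraicIndependent_rhoArc_ell2`, walls `sb_arcWall3(_pi)`, item-shape instances + §7 head `zA` / `zApi`, `linearIndependent_zA(pi)`, `linLiouville_zA(pi)`; 07 = §7a the ONE 2-adic cut `cutA` + **`form_lower_bound_A`** (exponent 9), `not_hyperLinLiouville_zA(pi)` (m₀ = 10), `sb_zA(pi)`, `finiteOrderLiouvilleSchanuel_at_zA(pi)`, `item33364_at_zA(pi)`, `item31077_at_zA`; 08 = §8 `rhoArc_position` (11 conjuncts by tree name) and its lemmas, `liouville_rhoArc`; 09 = §9 (A′) the twin σ° = Π(1 + 2·4^(−k!)): `arcNum2`, `arcOdd2`, `arcProdQ2`, `sigmaArc`, `liouville_sigmaArc`; 10 = §10 the lines of (ρ°, σ°): `linPoly`, `linF`, `linBasis`, `linScal`, `clearLin`,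 `truncGenericSeq_lin`, `qLin` / `qLin_tight`; 11 = §11 the twin cell `algebraicIndependent_twin_of_mvPolyMeasure`, walls `sb_twinWall3(_pi)`, item-shape instances + §12 head `zD` / `zDpi`, binders; 12 = §12a part 1 the archimedean two-level cut `cutD`, `cutD_succ_ne_zero`, `cutD_height_bound`; 13 = §12a part 2 **`form_lower_bound_D`** (exponent 7), `not_hyperLinLiouville_zD(pi)` (m₀ = 8), `sb_zD(pi)`, `item33364_at_zD(pi)`, `zD_shape`. PORT EDITS (census convention): `set_option linter.dupNamespace false` dropped; 77 one-line helper docstrings added (statements quoted); per-part private helper copies; sections `Extraction` / `Members` / `TwinMembers` closed and re-opened across the cuts with their `variable` / `open` lines; statements and proofs otherwise verbatim (no renames; K's own private markers kept). `--supports stmt-Schanuel-33364`; no census credit carried; rung 0 — nothing here proves Schanuel; no ∀-item moves; 33364, 33363, 31077 stay OPEN.)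
-/

noncomputable section

open Polynomial LiouvilleNumber
open scoped Nat

namespace Summit.Schanuel.Schanuel.Theorems.RootDecomp1KArcCell

open Summit.Schanuel.Schanuel.Theorems.RootDecomp1KCollarCell
open Summit.Schanuel.Schanuel.Theorems.RootDecomp1KGapCell
open Summit.Schanuel.Schanuel.Theorems.RootDecomp1KTwoBaseCell
open Summit.Schanuel.Schanuel.Theorems.RootDecomp1KRelLiouvilleCell
open Summit.Schanuel.Schanuel.Theorems.RootDecomp1KNWMeasureHolds (polyMeasure_exp_one_holds)
open Summit.Schanuel.Schanuel.Theorems.RootDecomp1KHyper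
open Summit.Schanuel.Schanuel.Theorems.RootDecomp1KHyper.HyperCell
open Summit.Schanuel.Schanuel.Theorems.RootDecomp1KCommonRadixCell (TruncGeneric algebraicIndependent_liouville_of_truncGeneric)

/-- `(1, u⃗)` is ℚ-linearly independent when `u⃗` is algebraically independent over `ℚ` (re-proof of the private GapCell06 /
CollarWall05 helper of the same name). -/
private theorem linearIndependent_one_cons_of_algebraicIndependent {m : ℕ} {u : Fin m → ℂ}
    (hu : AlgebraicIndependent ℚ u) : LinearIndependent ℚ (Fin.cons (1 : ℂ) u : Fin (m + 1) → ℂ) := by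
  classical
  rw [linearIndependent_finCons]
  refine ⟨hu.linearIndependent, fun hmem => ?_⟩
  obtain ⟨c, hc⟩ := (Submodule.mem_span_range_iff_exists_fun (R := ℚ)).mp hmem
  set P : MvPolynomial (Fin m) ℚ := ∑ i, MvPolynomial.C (c i) * MvPolynomial.X i - 1 with hP
  have hval : MvPolynomial.aeval u P = 0 := by
    simp only [hP, map_sub, map_sum, map_mul, MvPolynomial.aeval_C, MvPolynomial.aeval_X, map_one]
    rw [← hc]
    simp [Algebra.smul_def]
  have hP0 : P = 0 :=
    (algebraicIndependent_iff_injective_aeval.mp hu) (by rw [hval, map_zero])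
  have hcc : MvPolynomial.constantCoeff P = -1 := by
    simp [hP, MvPolynomial.constantCoeff_X]
  rw [hP0, map_zero] at hcc
  norm_num at hcc

/-- Scaling by `π ≠ 0` preserves ℚ-linear independence (re-proof of the private GapCell06 / CollarWall05 helper). -/
private theorem linearIndependent_pi_mul {N : ℕ} {v : Fin N → ℂ} (hv : LinearIndependent ℚ v) :
    LinearIndependent ℚ (fun i => (Real.pi : ℂ) * v i) := by
  rw [Fintype.linearIndependent_iff] at hv ⊢
  intro g hg
  apply hv g
  have hπ0 : (Real.pi : ℂ) ≠ 0 := by exact_mod_cast Real.pi_ne_zero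
  have h : (Real.pi : ℂ) * ∑ i, g i • v i = 0 := by
    rw [Finset.mul_sum]
    calc ∑ i, (Real.pi : ℂ) * (g i • v i) = ∑ i, g i • ((Real.pi : ℂ) * v i) :=
          Finset.sum_congr rfl fun i _ => by rw [mul_smul_comm]
      _ = 0 := hg
  exact (mul_eq_zero.mp h).resolve_left hπ0

/-! ## §11  THE TWIN CELL `(ρ°, σ°) × θ⃗`, ITS WALLS `SB 3 (1, ρ°, σ°)` / π-twin, and the ITEM-SHAPE instances — HYPOTHESIS-FREE -/
section TwinWalls

open IntermediateField

variable {n : ℕ}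

/-- **THE TWIN CELL.** `(ρ°, σ°, θ⃗)` is algebraically independent over `ℚ` for EVERY block `θ⃗` of polynomial measure — from (E3)
`algebraicIndependent_of_truncGenericSeq` at `A = 4, B = 5, c = 36` and the line certificate `truncGenericSeq_lin`. -/
theorem algebraicIndependent_twin_of_mvPolyMeasure {θ : Fin n → ℂ} (hθ : MvPolyMeasure θ) :
    AlgebraicIndependent ℚ
      (Sum.elim ![((rhoArc : ℝ) : ℂ), ((sigmaArc : ℝ) : ℂ)] θ : Fin 2 ⊕ Fin n → ℂ) := by
  have h := algebraicIndependent_of_truncGenericSeq (ξ := ![rhoArc, sigmaArc]) (x := ![arcProdQ, arcProdQ2])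
    (A := 4) (B := 5) (c := 36) (by norm_num) (by norm_num) ?_ ?_ ?_ truncGenericSeq_lin hθ
  · have e : (Sum.elim (fun i => (((![rhoArc, sigmaArc] : Fin 2 → ℝ) i : ℝ) : ℂ)) θ :
        Fin 2 ⊕ Fin n → ℂ) = Sum.elim ![((rhoArc : ℝ) : ℂ), ((sigmaArc : ℝ) : ℂ)] θ := by
      funext x
      rcases x with i | j
      · fin_cases i <;> rfl
      · rfl
    rw [e] at h
    exact h
  · intro i N
    fin_cases i
    · show (arcProdQ N).den ≤ 2 ^ (4 * N !)
      rw [den_arcProdQ_eq_two_pow]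
      exact Nat.pow_le_pow_right two_pos (by have := dfac_le N; omega)
    · show (arcProdQ2 N).den ≤ 2 ^ (4 * N !)
      have h1 : (arcProdQ2 N).den ∣ 2 ^ (2 * dfac N) := by have := den_arcProdQ2_dvd N; exact_mod_cast this
      exact (Nat.le_of_dvd (by positivity) h1).trans
        (Nat.pow_le_pow_right two_pos (by have := dfac_le N; omega))
  · intro i N
    fin_cases i
    · show |((arcProdQ N : ℚ) : ℝ)| ≤ 5
      rw [abs_of_pos (by exact_mod_cast arcProdQ_pos N)]
      have := arcProdQ_lt_three N; linarith
    · show |((arcProdQ2 N : ℚ) : ℝ)| ≤ 5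
      rw [abs_of_pos (by exact_mod_cast arcProdQ2_pos N)]
      exact (arcProdQ2_lt_five N).le
  · intro i N
    fin_cases i
    · exact abs_rhoArc_sub_arcProdQ_le' N
    · exact abs_sigmaArc_sub_arcProdQ2_le N

/-- The PAIR `(ρ°, σ°)` is algebraically independent — HYPOTHESIS-FREE. -/
theorem algebraicIndependent_rhoArc_sigmaArc :
    AlgebraicIndependent ℚ ![((rhoArc : ℝ) : ℂ), ((sigmaArc : ℝ) : ℂ)] :=
  (algebraicIndependent_twin_of_mvPolyMeasure
    (mvPolyMeasure_one_of_polyMeasure polyMeasure_exp_one_holds)).comp Sum.inl Sum.inl_injective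

/-- **THE TWIN WALL `(1, ρ°, σ°)`: `SB 3` — HYPOTHESIS-FREE** (`θ⃗ = (e)`). -/
theorem sb_twinWall3 : SB 3 ![(1 : ℂ), ((rhoArc : ℝ) : ℂ), ((sigmaArc : ℝ) : ℂ)] := by
  have hai := algebraicIndependent_twin_of_mvPolyMeasure
    (mvPolyMeasure_one_of_polyMeasure polyMeasure_exp_one_holds)
  refine sb_of_algebraicIndependent hai (by simp) ?_
  intro x
  rcases x with i | j
  · simp only [Sum.elim_inl]
    refine Fin.cases ?_ (fun j => ?_) i
    · simp only [Matrix.cons_val_zero]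
      exact subset_adjoin ℚ _ (Or.inl (Or.inl ⟨1, by simp⟩))
    · have hj : j = 0 := Subsingleton.elim _ _
      subst hj
      simp only [Matrix.cons_val_succ, Matrix.cons_val_zero]
      exact subset_adjoin ℚ _ (Or.inl (Or.inl ⟨2, by simp⟩))
  · simp only [Sum.elim_inr]
    refine subset_adjoin ℚ _ (Or.inl (Or.inr ⟨0, ?_⟩))
    fin_cases j; simp

/-- **THE TWIN WALL, π-twin `(π, πρ°, πσ°)`: `SB 3` — HYPOTHESIS-FREE** (`θ⃗ = (π)`). -/
theorem sb_twinWall3_pi :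
    SB 3 ![(Real.pi : ℂ), (Real.pi : ℂ) * ((rhoArc : ℝ) : ℂ), (Real.pi : ℂ) * ((sigmaArc : ℝ) : ℂ)] := by
  set z : Fin 3 → ℂ :=
    ![(Real.pi : ℂ), (Real.pi : ℂ) * ((rhoArc : ℝ) : ℂ), (Real.pi : ℂ) * ((sigmaArc : ℝ) : ℂ)] with hz
  have hπ0 : (Real.pi : ℂ) ≠ 0 := by exact_mod_cast Real.pi_ne_zero
  have hzm : ∀ i, z i ∈ adjoin ℚ (SFset z ∪ {Complex.I}) := fun i =>
    subset_adjoin ℚ _ (Or.inl (Or.inl ⟨i, rfl⟩))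
  have hai := algebraicIndependent_twin_of_mvPolyMeasure (mvPolyMeasure_one_of_polyMeasure polyMeasure_pi)
  refine sb_of_algebraicIndependent hai (by simp) ?_
  intro x
  rcases x with i | j
  · simp only [Sum.elim_inl]
    refine Fin.cases ?_ (fun j => ?_) i
    · simp only [Matrix.cons_val_zero]
      have e : ((rhoArc : ℝ) : ℂ) = z 1 / z 0 := by simp [hz, mul_div_cancel_left₀ _ hπ0]
      rw [e]; exact div_mem (hzm 1) (hzm 0)
    · have hj : j = 0 := Subsingleton.elim _ _
      subst hj
      simp only [Matrix.cons_val_succ, Matrix.cons_val_zero]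
      have e : ((sigmaArc : ℝ) : ℂ) = z 2 / z 0 := by simp [hz, mul_div_cancel_left₀ _ hπ0]
      rw [e]; exact div_mem (hzm 2) (hzm 0)
  · simp only [Sum.elim_inr]
    have e : (![(Real.pi : ℂ)] : Fin 1 → ℂ) j = z 0 := by fin_cases j; simp [hz]
    rw [e]; exact hzm 0

/-- **ITEM 33364 ON THE TWIN WALL `(1, ρ°, σ°)` — HYPOTHESIS-FREE** (binders of
`Summit.Schanuel.Schanuel.Theses.RootDecomp1K.FiniteOrderLiouvilleSchanuel` VERBATIM + ONE range line). -/
theorem finiteOrderLiouvilleSchanuel_twinWall3 :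
    ∀ (n : ℕ) (z : Fin n → ℂ), LinearIndependent ℚ z →
      Set.range z = Set.range ![(1 : ℂ), ((rhoArc : ℝ) : ℂ), ((sigmaArc : ℝ) : ℂ)] →
      (∀ ω : ℕ, ∃ h : Fin n → ℤ, h ≠ 0 ∧ ‖∑ i, (h i : ℂ) * z i‖ < 1 / (1 + ∑ i, (|h i| : ℝ)) ^ ω) →
      (¬ ∀ m : ℕ, ∃ h : Fin n → ℤ, h ≠ 0 ∧
        ‖∑ i, (h i : ℂ) * z i‖ < Real.exp (-((1 + ∑ i, (|h i| : ℝ)) ^ m))) →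
      (n : Cardinal) ≤ Algebra.trdeg ℚ
        ↥(IntermediateField.adjoin ℚ (Set.range z ∪ Set.range (Complex.exp ∘ z))) := by
  intro n z hz hrange _ _
  exact sb_of_range_eq' hz.injective hrange sb_twinWall3

/-- **ITEM 33364 ON THE TWIN WALL, π-twin — HYPOTHESIS-FREE.** -/
theorem finiteOrderLiouvilleSchanuel_twinWall3_pi :
    ∀ (n : ℕ) (z : Fin n → ℂ), LinearIndependent ℚ z →
      Set.range z = Set.range ![(Real.pi : ℂ), (Real.pi : ℂ) * ((rhoArc : ℝ) : ℂ),
        (Real.pi : ℂ) * ((sigmaArc : ℝ) : ℂ)] →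
      (∀ ω : ℕ, ∃ h : Fin n → ℤ, h ≠ 0 ∧ ‖∑ i, (h i : ℂ) * z i‖ < 1 / (1 + ∑ i, (|h i| : ℝ)) ^ ω) →
      (¬ ∀ m : ℕ, ∃ h : Fin n → ℤ, h ≠ 0 ∧
        ‖∑ i, (h i : ℂ) * z i‖ < Real.exp (-((1 + ∑ i, (|h i| : ℝ)) ^ m))) →
      (n : Cardinal) ≤ Algebra.trdeg ℚ
        ↥(IntermediateField.adjoin ℚ (Set.range z ∪ Set.range (Complex.exp ∘ z))) := by
  intro n z hz hrange _ _
  exact sb_of_range_eq' hz.injective hrange sb_twinWall3_pi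

/-- **ITEM 31077 ON THE TWIN WALL `(1, ρ°, σ°)` — HYPOTHESIS-FREE** (bookkeeping). -/
theorem coordLiouvilleSchanuel_twinWall3 :
    ∀ (n : ℕ) (z : Fin n → ℂ), LinearIndependent ℚ z →
      Set.range z = Set.range ![(1 : ℂ), ((rhoArc : ℝ) : ℂ), ((sigmaArc : ℝ) : ℂ)] →
      (∃ w ∈ Submodule.span ℚ (Set.range z), Liouville w.re ∨ Liouville w.im) →
      (n : Cardinal) ≤ Algebra.trdeg ℚ
        ↥(IntermediateField.adjoin ℚ (Set.range z ∪ Set.range (Complex.exp ∘ z))) := by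
  intro n z hz hrange _
  exact sb_of_range_eq' hz.injective hrange sb_twinWall3

end TwinWalls

/-! ## §12  THE TWIN MEMBERS `zD = (1, ρ°, σ°)`, `zD^π = (π, πρ°, πσ°)` — every binder of item 33364 CERTIFIED, hyp-free

The form bound (M′) here is ARCHIMEDEAN and uses NO parity below the top level: cut at level `N+1`, `N` = the least level `≥ 3`
with `Σ|gᵢ| < 2^{N!}`; the cut integer `J_{N+1}(g) = g₀·4^{D_{N+1}} + g₁·arcNum (N+1) + g₂·arcNum2 (N+1)` obeys the TWO-LEVEL identity
`J_{N+1} = 4^{(N+1)!}·J_N + Y_N`, `Y_N = g₁·arcNum N + 2g₂·arcNum2 N` with `|Y_N| < 4^{(N+1)!}` (the SAME gap principle as (E1), on the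
line `λ_N`), so `J_{N+1} = 0` forces `J_N = 0 = Y_N`, whence `g₀·4^{D_N} = g₂·arcNum2 N = g₂·2^{N+1}·(odd)` and `2^{2D_N − N − 1} ∣ g₂`,
impossible below `2^{N!}` unless `g = 0`. -/
section TwinMembers

open IntermediateField

/-- THE TWIN MEMBER `zD = (1, ρ°, σ°)`. -/
def zD : Fin 3 → ℂ := ![(1 : ℂ), ((rhoArc : ℝ) : ℂ), ((sigmaArc : ℝ) : ℂ)]

/-- THE π-TWIN `zD^π = (π, πρ°, πσ°)`. -/
def zDpi : Fin 3 → ℂ :=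
  ![(Real.pi : ℂ), (Real.pi : ℂ) * ((rhoArc : ℝ) : ℂ), (Real.pi : ℂ) * ((sigmaArc : ℝ) : ℂ)]

/-- (i) `LinearIndependent ℚ zD` — HYPOTHESIS-FREE. -/
theorem linearIndependent_zD : LinearIndependent ℚ zD := by
  have e : zD = (Fin.cons (1 : ℂ) ![((rhoArc : ℝ) : ℂ), ((sigmaArc : ℝ) : ℂ)] : Fin 3 → ℂ) := by
    funext i; fin_cases i <;> simp [zD]
  rw [e]; exact linearIndependent_one_cons_of_algebraicIndependent algebraicIndependent_rhoArc_sigmaArc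

/-- (i^π) `LinearIndependent ℚ zD^π` — HYPOTHESIS-FREE. -/
theorem linearIndependent_zDpi : LinearIndependent ℚ zDpi := by
  have e : zDpi = fun i => (Real.pi : ℂ) * zD i := by
    funext i; fin_cases i <;> simp [zDpi, zD]
  rw [e]; exact linearIndependent_pi_mul linearIndependent_zD

/-- (ii) `LinLiouville zD` through the prefix `(1, ρ°)` (`ρ°` is Liouville: `liouville_rhoArc`) — HYPOTHESIS-FREE. -/
theorem linLiouville_zD : LinLiouville zD := by
  refine linLiouville_of_prefix (k := 2) (n := 3) (by norm_num) ?_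
  have h2 : (fun i : Fin 2 => zD (Fin.castLE (show 2 ≤ 3 by norm_num) i)) =
      ![(1 : ℂ), ((rhoArc : ℝ) : ℂ) * 1] := by
    funext i; fin_cases i <;> simp [zD]
  rw [h2]
  exact linLiouville_of_liouville_ratio liouville_rhoArc 1

/-- (ii^π) `LinLiouville zD^π` — HYPOTHESIS-FREE. -/
theorem linLiouville_zDpi : LinLiouville zDpi := by
  refine linLiouville_of_prefix (k := 2) (n := 3) (by norm_num) ?_
  have h2 : (fun i : Fin 2 => zDpi (Fin.castLE (show 2 ≤ 3 by norm_num) i)) =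
      ![(Real.pi : ℂ), ((rhoArc : ℝ) : ℂ) * (Real.pi : ℂ)] := by
    funext i; fin_cases i <;> simp [zDpi, mul_comm]
  rw [h2]
  exact linLiouville_of_liouville_ratio liouville_rhoArc (Real.pi : ℂ)

/-- The linear form at `zD = (1, ρ°, σ°)`: `Σ g i · zD i = g 0 + g 1·ρ° + g 2·σ°` (as a real number cast to `ℂ`). -/
theorem zD_form (g : Fin 3 → ℤ) :
    ∑ i, (g i : ℂ) * zD i = (((g 0 : ℝ) + g 1 * rhoArc + g 2 * sigmaArc : ℝ) : ℂ) := by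
  rw [Fin.sum_univ_three]
  simp only [zD, Matrix.cons_val_zero, Matrix.cons_val_one, Matrix.cons_val_two, Matrix.head_cons,
    Matrix.tail_cons]
  push_cast; ring

/-- The linear form at `zD^π = (π, πρ°, πσ°)`: `Σ g i · zDpi i = π · (g 0 + g 1·ρ° + g 2·σ°)`. -/
theorem zDpi_form (g : Fin 3 → ℤ) :
    ∑ i, (g i : ℂ) * zDpi i =
      (Real.pi : ℂ) * (((g 0 : ℝ) + g 1 * rhoArc + g 2 * sigmaArc : ℝ) : ℂ) := by
  rw [Fin.sum_univ_three]
  simp only [zDpi, Matrix.cons_val_zero, Matrix.cons_val_one, Matrix.cons_val_two, Matrix.head_cons,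
    Matrix.tail_cons]
  push_cast; ring

/-- Norm of the linear form at `zD`: `‖Σ g i · zD i‖ = |g 0 + g 1·ρ° + g 2·σ°|`. -/
theorem norm_zD_form (g : Fin 3 → ℤ) :
    ‖∑ i, (g i : ℂ) * zD i‖ = |(g 0 : ℝ) + g 1 * rhoArc + g 2 * sigmaArc| := by
  rw [zD_form, Complex.norm_real, Real.norm_eq_abs]

/-- Norm of the linear form at `zD^π`: `‖Σ g i · zDpi i‖ = π · |g 0 + g 1·ρ° + g 2·σ°|`. -/
theorem norm_zDpi_form (g : Fin 3 → ℤ) :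
    ‖∑ i, (g i : ℂ) * zDpi i‖ = Real.pi * |(g 0 : ℝ) + g 1 * rhoArc + g 2 * sigmaArc| := by
  rw [zDpi_form, norm_mul, Complex.norm_real, Complex.norm_real, Real.norm_eq_abs, Real.norm_eq_abs,
    abs_of_pos Real.pi_pos]

end TwinMembers

end Summit.Schanuel.Schanuel.Theorems.RootDecomp1KArcCell

end
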